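import Summits.AtomisticToContinuum.Crystallization.Theses.NashClassCertificates
import Summits.AtomisticToContinuum.Crystallization.Theorems.NashClassCertificatesNashTwoShellGapNashSeparation
import Summits.AtomisticToContinuum.Crystallization.Theorems.NashClassCertificatesNashTwoShellGapReductions
import Summits.AtomisticToContinuum.Crystallization.Theorems.NashClassCertificatesNashTwoShellGapExposedBadGap

/-!
# Crux `NashTwoShellGap` (stmt-AtomisticToContinuum-16826), line `birth`: the composition as a
# theorem of the tree, and the split is EXACT (crux ⇔ exposed-bad gap ∧ jammed-bad gap)

The registered skeleton `Cruxes/NashTwoShellGap/Lines/birth.lean` derives the crux from three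
stubs: the separation bootstrap `stub_nashSeparation` (LANDED,
`NashTwoShellGapNashSeparation.stub_nashSeparation`), the exposed-bad gap and the jammed-bad gap
(both open; exposed = a `9/10`-hole within `6/5`).  This file lands the composition itself
(`stub_birthComposition`: exposed gap → jammed gap → crux, with `g := min g_S g_F / 2` and the
disjoint split of the bad count), so that the crux is CLOSED MODULO the two registered gap stubs by
a tree theorem, and records that the split loses nothing: the crux implies each half
(`NashTwoShellGapExposedBadGap.exposedBadGap_of_nashTwoShellGap`,
`NashTwoShellGapReductions.jammedBadGap_of_nashTwoShellGap`), hence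
`stub_birthIff : crux ↔ exposed gap ∧ jammed gap`.  No definitions; all `[folklore]`.
-/

noncomputable section

namespace Summit.AtomisticToContinuum.Crystallization.Theorems.NashTwoShellGapBirthComposition

open scoped BigOperators Classical
open Literature.MathematicalPhysics.StatisticalMechanics Literature.Geometry.DiscreteGeometry
open Summit.AtomisticToContinuum.Crystallization.Theses

/-- A subtype of `Fin N` splits along any second predicate: `#{B} = #{B ∧ E} + #{B ∧ ¬E}`.
[folklore] -/
theorem natCard_split_and {N : ℕ} (B E : Fin N → Prop) :
    Nat.card {i : Fin N // B i} = Nat.card {i : Fin N // B i ∧ E i} + Nat.card {i : Fin N // B i ∧ ¬ E i} := by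
  classical
  calc Nat.card {i : Fin N // B i}
      = Nat.card ({a : {i : Fin N // B i} // E a.1} ⊕ {a : {i : Fin N // B i} // ¬ E a.1}) :=
        Nat.card_congr (Equiv.sumCompl (fun a : {i : Fin N // B i} => E a.1)).symm
    _ = Nat.card {a : {i : Fin N // B i} // E a.1} + Nat.card {a : {i : Fin N // B i} // ¬ E a.1} :=
        Nat.card_sum
    _ = Nat.card {i : Fin N // B i ∧ E i} + Nat.card {i : Fin N // B i ∧ ¬ E i} := by
        rw [Nat.card_congr (Equiv.subtypeSubtypeEquivSubtypeInter B E),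
          Nat.card_congr (Equiv.subtypeSubtypeEquivSubtypeInter B (fun i => ¬ E i))]

/-- **Registered sub-goal `stub_birthComposition`** — line `birth`'s composition as a tree theorem:
the exposed-bad gap and the jammed-bad gap on the `1/2`-separated Nash class imply the crux
(bootstrap `1/3 → 1/2` by the landed `stub_nashSeparation`; the bad set is the disjoint union of its
exposed and jammed parts; average the two inequalities with `g := min g_S g_F / 2`). [folklore] -/
theorem stub_birthComposition : (∃ g : ℝ, 0 < g ∧ ∀ (N : ℕ) (x : Fin N → EuclideanSpace ℝ (Fin 3)), (∀ i j : Fin N, i ≠ j → 1 / 2 ≤ dist (x i) (x j)) → (∀ (i : Fin N) (y : EuclideanSpace ℝ (Fin 3)), (∀ j : Fin N, j ≠ i → y ≠ x j) → Literature.MathematicalPhysics.StatisticalMechanics.siteEnergy Literature.MathematicalPhysics.StatisticalMechanics.lennardJones x i ≤ ∑ j ∈ Finset.univ.erase i, Literature.MathematicalPhysics.StatisticalMechanics.lennardJones (dist y (x j))) → (N : ℝ) * (⨅ Q : Literature.MathematicalPhysics.StatisticalMechanics.PeriodicConfiguration 3, Q.energyPerParticle Literature.MathematicalPhysics.StatisticalMechanics.lennardJones)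 + g * (Nat.card {i : Fin N // ¬ Literature.Geometry.DiscreteGeometry.IsTwoShellGood (1 / 20) (47 / 50) 1 x i ∧ ∃ p : EuclideanSpace ℝ (Fin 3), dist p (x i) ≤ 6 / 5 ∧ ∀ j : Fin N, 9 / 10 ≤ dist p (x j)} : ℝ) ≤ Literature.MathematicalPhysics.StatisticalMechanics.interactionEnergy Literature.MathematicalPhysics.StatisticalMechanics.lennardJones x) → (∃ g : ℝ, 0 < g ∧ ∀ (N : ℕ) (x : Fin N → EuclideanSpace ℝ (Fin 3)), (∀ i j : Fin N, i ≠ j → 1 / 2 ≤ dist (x i) (x j)) → (∀ (i : Fin N) (y : EuclideanSpace ℝ (Fin 3)), (∀ j : Fin N, j ≠ i → y ≠ x j) → Literature.MathematicalPhysics.StatisticalMechanics.siteEnergy Literature.MathematicalPhysics.StatisticalMechanics.lennardJones x i ≤ ∑ j ∈ Finset.univ.erase i, Literature.MathematicalPhysics.StatisticalMechanics.lennardJones (dist y (x j))) → (N : ℝ) * (⨅ Q : Literature.MathematicalPhysics.StatisticalMechanics.PeriodicConfiguration 3, Q.energyPerParticle Literature.MathematicalPhysics.StatisticalMechanics.lennardJones)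 + g * (Nat.card {i : Fin N // ¬ Literature.Geometry.DiscreteGeometry.IsTwoShellGood (1 / 20) (47 / 50) 1 x i ∧ ¬ ∃ p : EuclideanSpace ℝ (Fin 3), dist p (x i) ≤ 6 / 5 ∧ ∀ j : Fin N, 9 / 10 ≤ dist p (x j)} : ℝ) ≤ Literature.MathematicalPhysics.StatisticalMechanics.interactionEnergy Literature.MathematicalPhysics.StatisticalMechanics.lennardJones x) → Summit.AtomisticToContinuum.Crystallization.Theses.NashClassCertificates.NashTwoShellGap := by
  rintro ⟨gS, hgS, hS⟩ ⟨gF, hgF, hF⟩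
  refine ⟨min gS gF / 2, div_pos (lt_min hgS hgF) two_pos, ?_⟩
  intro N x h3 hnash
  have h2 : ∀ i j : Fin N, i ≠ j → 1 / 2 ≤ dist (x i) (x j) :=
    NashTwoShellGapNashSeparation.stub_nashSeparation N x h3 hnash
  have eS := hS N x h2 hnash
  have eF := hF N x h2 hnash
  have hnat := natCard_split_and
    (fun i : Fin N => ¬ IsTwoShellGood (1 / 20) (47 / 50) 1 x i)
    (fun i : Fin N => ∃ p : EuclideanSpace ℝ (Fin 3), dist p (x i) ≤ 6 / 5 ∧ ∀ j : Fin N, 9 / 10 ≤ dist p (x j))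
  have hsplit : (Nat.card {i : Fin N // ¬ IsTwoShellGood (1 / 20) (47 / 50) 1 x i} : ℝ) =
      (Nat.card {i : Fin N // ¬ IsTwoShellGood (1 / 20) (47 / 50) 1 x i ∧
          ∃ p : EuclideanSpace ℝ (Fin 3), dist p (x i) ≤ 6 / 5 ∧ ∀ j : Fin N, 9 / 10 ≤ dist p (x j)} : ℝ) +
      (Nat.card {i : Fin N // ¬ IsTwoShellGood (1 / 20) (47 / 50) 1 x i ∧
          ¬ ∃ p : EuclideanSpace ℝ (Fin 3), dist p (x i) ≤ 6 / 5 ∧ ∀ j : Fin N, 9 / 10 ≤ dist p (x j)} : ℝ) := by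
    exact_mod_cast hnat
  have hBS : (0 : ℝ) ≤ (Nat.card {i : Fin N // ¬ IsTwoShellGood (1 / 20) (47 / 50) 1 x i ∧
      ∃ p : EuclideanSpace ℝ (Fin 3), dist p (x i) ≤ 6 / 5 ∧ ∀ j : Fin N, 9 / 10 ≤ dist p (x j)} : ℝ) :=
    Nat.cast_nonneg _
  have hBF : (0 : ℝ) ≤ (Nat.card {i : Fin N // ¬ IsTwoShellGood (1 / 20) (47 / 50) 1 x i ∧
      ¬ ∃ p : EuclideanSpace ℝ (Fin 3), dist p (x i) ≤ 6 / 5 ∧ ∀ j : Fin N, 9 / 10 ≤ dist p (x j)} : ℝ) :=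
    Nat.cast_nonneg _
  have m1 := mul_le_mul_of_nonneg_right (min_le_left gS gF) hBS
  have m2 := mul_le_mul_of_nonneg_right (min_le_right gS gF) hBF
  rw [hsplit]
  linarith [m1, m2, eS, eF]

/-- **Registered sub-goal `stub_birthIff`** — the split of line `birth` is exact: the crux is
EQUIVALENT to the conjunction of its exposed-bad and jammed-bad gaps on the `1/2`-separated Nash
class (⇒: smaller counts on a smaller class; ⇐: `stub_birthComposition`). [folklore] -/
theorem stub_birthIff : Summit.AtomisticToContinuum.Crystallization.Theses.NashClassCertificates.NashTwoShellGap ↔ (∃ g : ℝ, 0 < g ∧ ∀ (N : ℕ) (x : Fin N → EuclideanSpace ℝ (Fin 3)), (∀ i j : Fin N, i ≠ j → 1 / 2 ≤ dist (x i) (x j)) → (∀ (i : Fin N) (y : EuclideanSpace ℝ (Fin 3)), (∀ j : Fin N, j ≠ i → y ≠ x j) → Literature.MathematicalPhysics.StatisticalMechanics.siteEnergy Literature.MathematicalPhysics.StatisticalMechanics.lennardJones x i ≤ ∑ j ∈ Finset.univ.erase i, Literature.MathematicalPhysics.StatisticalMechanics.lennardJones (dist y (x j))) → (N : ℝ) *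 (⨅ Q : Literature.MathematicalPhysics.StatisticalMechanics.PeriodicConfiguration 3, Q.energyPerParticle Literature.MathematicalPhysics.StatisticalMechanics.lennardJones) + g * (Nat.card {i : Fin N // ¬ Literature.Geometry.DiscreteGeometry.IsTwoShellGood (1 / 20) (47 / 50) 1 x i ∧ ∃ p : EuclideanSpace ℝ (Fin 3), dist p (x i) ≤ 6 / 5 ∧ ∀ j : Fin N, 9 / 10 ≤ dist p (x j)} : ℝ) ≤ Literature.MathematicalPhysics.StatisticalMechanics.interactionEnergy Literature.MathematicalPhysics.StatisticalMechanics.lennardJones x) ∧ (∃ g : ℝ, 0 < g ∧ ∀ (N : ℕ) (x : Fin N → EuclideanSpace ℝ (Fin 3)), (∀ i j : Fin N, i ≠ j → 1 / 2 ≤ dist (x i) (x j)) → (∀ (i : Fin N) (y : EuclideanSpace ℝ (Fin 3)), (∀ j : Fin N, j ≠ i → y ≠ x j) → Literature.MathematicalPhysics.StatisticalMechanics.siteEnergy Literature.MathematicalPhysics.StatisticalMechanics.lennardJones x i ≤ ∑ j ∈ Finset.univ.erase i, Literature.MathematicalPhysics.StatisticalMechanics.lennardJones (dist y (x j))) → (N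 : ℝ) * (⨅ Q : Literature.MathematicalPhysics.StatisticalMechanics.PeriodicConfiguration 3, Q.energyPerParticle Literature.MathematicalPhysics.StatisticalMechanics.lennardJones) + g * (Nat.card {i : Fin N // ¬ Literature.Geometry.DiscreteGeometry.IsTwoShellGood (1 / 20) (47 / 50) 1 x i ∧ ¬ ∃ p : EuclideanSpace ℝ (Fin 3), dist p (x i) ≤ 6 / 5 ∧ ∀ j : Fin N, 9 / 10 ≤ dist p (x j)} : ℝ) ≤ Literature.MathematicalPhysics.StatisticalMechanics.interactionEnergy Literature.MathematicalPhysics.StatisticalMechanics.lennardJones x) :=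
  ⟨fun h => ⟨NashTwoShellGapExposedBadGap.exposedBadGap_of_nashTwoShellGap h,
    NashTwoShellGapReductions.jammedBadGap_of_nashTwoShellGap h⟩,
    fun h => stub_birthComposition h.1 h.2⟩

end Summit.AtomisticToContinuum.Crystallization.Theorems.NashTwoShellGapBirthComposition

end
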